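import Literature.NumberTheory.Automorphic.AlgebraicWeightHeckeNilpotence
import Literature.NumberTheory.Automorphic.LatticeEigenvalueBound
import HarnessLib

/-!
# The eigenvalue bound `|Q(a)|^{q+1} ≤ |p|^s` for Hecke polynomials small in `𝕋(K^p)`

Topic `NumberTheory/Automorphic`; namespace `Literature.NumberTheory.Automorphic.AlgebraicWeight`.
Definitions with bodies, documented instances and theorems; no named fact, no `sorry`.

The continuity estimate of the proof of [Scholze2015, Thm. V.4.1 / Cor. V.4.2], assembled for the
algebraic coefficient system of `GL_n/K`: let `ξ₁ ∈ H^q(X_U, Ẽ_λ)` (`U = 𝒰.subgroup`) be a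
simultaneous eigenvector of the `T_{tⱼ}` with eigenvalues `aⱼ`, and suppose some `p^c ξ₁` lies in
the (finitely generated) image `L_S = realizeRange` of `H^q(Γ, indFun M_S) → H^q(X_U, Ẽ_λ)` for a
stage lattice `M_S`.  Then for every `s` there is an `r` such that every noncommutative polynomial
`Q` with `Q(𝒰.heckeOperator tⱼ)` vanishing in the factors `(r, s, b)`, `b ≤ q`, has
`‖Q(a)‖^{q+1} ≤ ‖p‖^s` (`norm_pow_succ_le_of_heckeOperator_eq_zero`):
`Q(T)^{q+1} L_S ⊆ p^s L_S` by `exists_eq_pow_smul_of_heckeOperator_eq_zero` and Hecke-equivariance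
of `realize`, and `LatticeEigenvalueBound.norm_le_of_eigenvector_mem_fg` applies to the eigenvector
`p^c ξ₁ ∈ L_S` of `Q(T)^{q+1}` with eigenvalue `Q(a)^{q+1}`.

Also: the `ℤ_p`-module structure on `H^q(X_U, Ẽ_λ)` (instances), `realizeLin` / `realizeRange`,
and `heckePolyEnd_apply_of_eigen` (`Q(T) ξ₁ = Q(a) ξ₁`).

## References

* P. Scholze, *On torsion in the cohomology of locally symmetric varieties*, Ann. of Math. 182
  (2015), §V.4, proof of Thm. V.4.1 and Cor. V.4.2. [Scholze2015]
-/

noncomputable section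

open CategoryTheory
open IsDedekindDomain NumberField
open Literature.NumberTheory.Automorphic.BigHeckeGLn Literature.NumberTheory.Automorphic.TwistedQuotient

namespace Literature.NumberTheory.Automorphic

namespace AlgebraicWeight

variable (K : Type) [Field K] [NumberField K] (n p : ℕ) [Fact p.Prime]
  (lam : (K →+* PadicAlgCl p) → Fin n → ℤ) (U : Subgroup (FiniteAdelicGL n K)) (q : ℕ)

/-! ### `H^q(X_U, Ẽ_λ)` as a `ℤ_p`-module -/

/-- `H^q(X_U, Ẽ_λ)` as a `ℤ_p`-module (restriction of scalars along `ℤ_p → ℚ̄_p`). [folklore] -/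
instance instModulePadicIntCohomology :
    Module ℤ_[p] (TwistedQuotient.cohomology (globalEmbedding n K) U
      ((ResGLnCohomology.padicCoeffRep n K p lam).comp (globalEmbedding n K)) q) :=
  Module.compHom _ (algebraMap ℤ_[p] (PadicAlgCl p))

/-- The `ℤ_p`-action on `H^q(X_U, Ẽ_λ)` is through `ℤ_p → ℚ̄_p`. [folklore] -/
theorem padicInt_smul_cohomology_def (z : ℤ_[p])
    (y : TwistedQuotient.cohomology (globalEmbedding n K) U
      ((ResGLnCohomology.padicCoeffRep n K p lam).comp (globalEmbedding n K)) q) :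
    z • y = algebraMap ℤ_[p] (PadicAlgCl p) z • y :=
  rfl

/-- `ℤ_p → ℚ̄_p → H^q(X_U, Ẽ_λ)` is a scalar tower. [folklore] -/
instance instIsScalarTowerPadicIntCohomology :
    IsScalarTower ℤ_[p] (PadicAlgCl p) (TwistedQuotient.cohomology (globalEmbedding n K) U
      ((ResGLnCohomology.padicCoeffRep n K p lam).comp (globalEmbedding n K)) q) :=
  ⟨fun z c y => by rw [padicInt_smul_cohomology_def, Algebra.smul_def, mul_smul]⟩

/-! ### The lattices `L_M = im(H^q(Γ, indFun M) → H^q(X_U, Ẽ_λ))` -/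

variable (M : Submodule ℤ_[p] (ResGLnCohomology.CoeffModule (PadicAlgCl p) n K lam))
  (hM : ∀ u ∈ U, ∀ m ∈ M, padicIntRep K n p lam u m ∈ M)

/-- `realize` as a `ℤ_p`-linear map. [folklore] -/
def realizeLin :
    groupCohomology (indFun (globalEmbedding n K) U (latticeRep U (padicIntRep K n p lam) M hM)) q
      →ₗ[ℤ_[p]] TwistedQuotient.cohomology (globalEmbedding n K) U
        ((ResGLnCohomology.padicCoeffRep n K p lam).comp (globalEmbedding n K)) q where
  toFun := realize K n p lam U M hM q
  map_add' x y := map_add _ x y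
  map_smul' z x := by
    rw [LinearMap.map_smulₛₗ, RingHom.id_apply, padicInt_smul_cohomology_def]

/-- Unfolding lemma. [folklore] -/
@[simp]
theorem realizeLin_apply (x) : realizeLin K n p lam U q M hM x = realize K n p lam U M hM q x :=
  rfl

/-- **`L_M = im(H^q(Γ, indFun M) → H^q(X_U, Ẽ_λ))`**, a `ℤ_p`-submodule (the image of the integral
cohomology `H^q(X_U, M̃)` in `H^q(X_U, Ẽ_λ)`). [cite: Scholze2015, §V.4 (H^i(X_K, 𝓜_{ξ,K}) ⊗ ℚ̄_p)] -/
def realizeRange : Submodule ℤ_[p] (TwistedQuotient.cohomology (globalEmbedding n K) U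
    ((ResGLnCohomology.padicCoeffRep n K p lam).comp (globalEmbedding n K)) q) :=
  LinearMap.range (realizeLin K n p lam U q M hM)

/-- Membership in `L_M`. [folklore] -/
theorem mem_realizeRange_iff (y) :
    y ∈ realizeRange K n p lam U q M hM ↔ ∃ x, realize K n p lam U M hM q x = y :=
  LinearMap.mem_range

/-- `realize x ∈ L_M`. [folklore] -/
theorem realize_mem_realizeRange (x) : realize K n p lam U M hM q x ∈ realizeRange K n p lam U q M hM :=
  (mem_realizeRange_iff K n p lam U q M hM _).2 ⟨x, rfl⟩

/-- **`L_M` is finitely generated when `H^q(Γ, indFun M)` is.** [folklore] -/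
theorem realizeRange_fg
    [Module.Finite ℤ_[p] (groupCohomology (indFun (globalEmbedding n K) U
      (latticeRep U (padicIntRep K n p lam) M hM)) q)] :
    (realizeRange K n p lam U q M hM).FG := by
  rw [realizeRange, LinearMap.range_eq_map]
  exact Submodule.FG.map _ Module.Finite.fg_top

/-! ### `Q(T)` on a simultaneous eigenvector -/

variable {I : Type*} (t : I → FiniteAdelicGL n K)

/-- **`Q(T) ξ = Q(a) ξ`** for a simultaneous eigenvector `ξ` of the `T_{tⱼ}` with eigenvalues `aⱼ`.
[folklore] -/
theorem heckePolyEnd_apply_of_eigen (a : I → PadicAlgCl p)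
    {ξ : TwistedQuotient.cohomology (globalEmbedding n K) U
      ((ResGLnCohomology.padicCoeffRep n K p lam).comp (globalEmbedding n K)) q}
    (hξ : ∀ i, TwistedQuotient.heckeEnd (globalEmbedding n K) U
      ((ResGLnCohomology.padicCoeffRep n K p lam).comp (globalEmbedding n K)) (t i) q ξ = a i • ξ)
    (Q : FreeRing I) :
    heckePolyEnd K n p lam U t q Q ξ = FreeRing.lift a Q • ξ := by
  induction Q using FreeRing.induction_on with
  | hn1 => rw [map_neg, map_one, map_neg, map_one, neg_smul, one_smul]; rfl
  | hb i => rw [heckePolyEnd_of_apply, FreeRing.lift_of, hξ i]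
  | ha Q₁ Q₂ h₁ h₂ => rw [map_add, map_add, LinearMap.add_apply, h₁, h₂, add_smul]
  | hm Q₁ Q₂ h₁ h₂ => rw [map_mul, map_mul, Module.End.mul_apply, h₂, map_smul, h₁, smul_smul, mul_comm]

/-- Powers: `Q(T)^m ξ = Q(a)^m ξ`. [folklore] -/
theorem heckePolyEnd_pow_apply_of_eigen (a : I → PadicAlgCl p)
    {ξ : TwistedQuotient.cohomology (globalEmbedding n K) U
      ((ResGLnCohomology.padicCoeffRep n K p lam).comp (globalEmbedding n K)) q}
    (hξ : ∀ i, TwistedQuotient.heckeEnd (globalEmbedding n K) U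
      ((ResGLnCohomology.padicCoeffRep n K p lam).comp (globalEmbedding n K)) (t i) q ξ = a i • ξ)
    (Q : FreeRing I) (m : ℕ) :
    (heckePolyEnd K n p lam U t q Q ^ m) ξ = FreeRing.lift a Q ^ m • ξ := by
  induction m with
  | zero => rw [pow_zero, pow_zero, one_smul]; rfl
  | succ m ih =>
    rw [pow_succ, pow_succ', Module.End.mul_apply, heckePolyEnd_apply_of_eigen K n p lam U q t a hξ,
      map_smul, ih, smul_smul, mul_comm]

/-! ### The bound -/

/-- **`‖Q(a)‖^{q+1} ≤ ‖p‖^s` for `Q(T)` small in `𝕋(K^p)`** (the continuity estimate of the proof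
of [Scholze2015, Thm. V.4.1 / Cor. V.4.2]): given a tame level `𝒰`, an integral stage `S`, `s` and
`q`, there is `r` such that for every simultaneous eigenvector `ξ₁ ≠ 0` of the `T_{tⱼ}` in
`H^q(X_U, Ẽ_λ)` with eigenvalues `aⱼ`, some `p`-power multiple of which lies in the finitely
generated lattice `L_{M_S}`, every `Q` with `Q(𝒰.heckeOperator tⱼ) = 0` in the factors `(r, s, b)`,
`b ≤ q`, satisfies `‖Q(a)‖^{q+1} ≤ ‖p‖^s`. [cite: Scholze2015, §V.4 (proof of Thm. V.4.1)] -/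
theorem norm_pow_succ_le_of_heckeOperator_eq_zero (𝒰 : TameLevel n K p)
    {S : Finset (PadicAlgCl p)} (hS : ∀ c ∈ S, ‖c‖ ≤ 1) (s q : ℕ) (t : I → FiniteAdelicGL n K)
    (ht : ∀ i, ResGLnCohomology.padicCoeffRep n K p lam (t i) = 1)
    (hconjₜ : ∀ (r : ℕ) (i : I) (u : 𝒰.subgroup), ∃ a ∈ 𝒰.tower r, ∃ b ∈ 𝒰.tower r,
      (u : FiniteAdelicGL n K) * t i * (u : FiniteAdelicGL n K)⁻¹ = a * t i * b)
    (hbijₜ : ∀ (r : ℕ) (i : I), Set.BijOn (Subgroup.quotientMapOfLE (𝒰.tower_le r))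
      (ArithmeticQuotient.doubleCosetQuot (𝒰.tower r) (t i))
      (ArithmeticQuotient.doubleCosetQuot 𝒰.subgroup (t i))) :
    ∃ r : ℕ, ∀ Q : FreeRing I,
      (∀ b ≤ q, FreeRing.lift (fun j => 𝒰.heckeOperator (t j)) Q (r, s, b) = 0) →
      ∀ (ξ₁ : TwistedQuotient.cohomology (globalEmbedding n K) 𝒰.subgroup
          ((ResGLnCohomology.padicCoeffRep n K p lam).comp (globalEmbedding n K)) q)
        (a : I → PadicAlgCl p),
        ξ₁ ≠ 0 →
        (∀ i, TwistedQuotient.heckeEnd (globalEmbedding n K) 𝒰.subgroup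
          ((ResGLnCohomology.padicCoeffRep n K p lam).comp (globalEmbedding n K)) (t i) q ξ₁ =
            a i • ξ₁) →
        (realizeRange K n p lam 𝒰.subgroup q (stageLattice K n p lam S)
          (stageLattice_stable K n p lam 𝒰 S)).FG →
        ∀ c : ℕ, ((p : PadicAlgCl p) ^ c) • ξ₁ ∈ realizeRange K n p lam 𝒰.subgroup q
            (stageLattice K n p lam S) (stageLattice_stable K n p lam 𝒰 S) →
        ‖FreeRing.lift a Q‖ ^ (q + 1) ≤ ‖(p : PadicAlgCl p)‖ ^ s := by
  obtain ⟨r, hr⟩ := exists_eq_pow_smul_of_heckeOperator_eq_zero K n p lam 𝒰 hS s q t ht hconjₜ hbijₜ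
  refine ⟨r, fun Q hQ ξ₁ a hξ0 hξ hfg c hc => ?_⟩
  have hp : (p : ℕ).Prime := Fact.out
  -- `N = Q(T)^{q+1}` maps `L` into `p^s L`
  have hN : ∀ v ∈ realizeRange K n p lam 𝒰.subgroup q (stageLattice K n p lam S)
      (stageLattice_stable K n p lam 𝒰 S),
      ∃ w ∈ realizeRange K n p lam 𝒰.subgroup q (stageLattice K n p lam S)
        (stageLattice_stable K n p lam 𝒰 S),
        (heckePolyEnd K n p lam 𝒰.subgroup t q Q ^ (q + 1)) v = ((p : ℤ_[p]) ^ s : ℤ_[p]) • w := by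
    intro v hv
    obtain ⟨x, rfl⟩ := (mem_realizeRange_iff K n p lam 𝒰.subgroup q _ _ v).1 hv
    obtain ⟨y, hy⟩ := hr Q hQ x
    refine ⟨realize K n p lam 𝒰.subgroup _ _ q y, realize_mem_realizeRange K n p lam 𝒰.subgroup q
      _ _ y, ?_⟩
    rw [← realize_heckePolyIndEnd_pow K n p lam 𝒰.subgroup _ _ t ht q Q (q + 1) x, hy,
      LinearMap.map_smulₛₗ, padicInt_smul_cohomology_def, Nat.cast_pow]
  -- the eigenvector `η = p^c ξ₁ ∈ L` of `N`, eigenvalue `Q(a)^{q+1}`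
  have hη0 : ((p : PadicAlgCl p) ^ c) • ξ₁ ≠ 0 :=
    smul_ne_zero (pow_ne_zero c (Nat.cast_ne_zero.2 hp.ne_zero)) hξ0
  have hμ : (heckePolyEnd K n p lam 𝒰.subgroup t q Q ^ (q + 1)) (((p : PadicAlgCl p) ^ c) • ξ₁) =
      (FreeRing.lift a Q ^ (q + 1)) • (((p : PadicAlgCl p) ^ c) • ξ₁) := by
    rw [map_smul, heckePolyEnd_pow_apply_of_eigen K n p lam 𝒰.subgroup q t a hξ, smul_comm]
  have h := norm_le_of_eigenvector_mem_fg
    (realizeRange K n p lam 𝒰.subgroup q (stageLattice K n p lam S)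
      (stageLattice_stable K n p lam 𝒰 S))
    ((heckePolyEnd K n p lam 𝒰.subgroup t q Q ^ (q + 1) :) ) s hN hfg hc hη0 hμ
  rwa [norm_pow] at h

end AlgebraicWeight

end Literature.NumberTheory.Automorphic
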